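import Summits.CriticalPhenomena.PercolationContinuityZ3.Theorems.Transplant.GrigorchukPowerResolventIdentity
import HarnessLib

/-!
# W4 S3b-β «ResolventIdentity» (second file): uniqueness of the lace kernel, the trivial character `χ⁻¹ = a⁻¹ − 4kp`, `Ψ = a − Ω` with `|⟪η,(Ψ − a)η⟫| ≤ B κ(η)`,
# the tangent inequality `Ψ⁻¹ ≽ 2a⁻¹ − a⁻²Ψ`, and the RESOLVENT FORM LOWER BOUND `⟪η, T⁻¹ η⟫ ≥ χ⁻¹‖η‖² + (4kp − a⁻²B) κ(η)`

Proof file (`--supports stmt-CriticalPhenomena-4575 --as helper`), lane `prim-bschramm`, seat `prim-bschramm-gen-1` gen 13 (GEN pen); item β of P3-NILPOTENT §39 (39.1),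
this is β₂ = (β5)–(β9) over β₁ «GrigorchukPowerResolventIdentity» (HOLD/GATED on α ACCEPTED + the lead's line — typed ahead, filed only when opened).  Serves S3b′
`stub_fBoot_le_of_laceBound` (v1.8 :80) via P3-NILPOTENT §37.2 (ii)–(iv); ASSERTS NOTHING about it and nothing about S3a′ (everything is conditional on a lace kernel
`IsLaceKernel k p K` with `‖K‖₁ < 1`, whose existence is NOT claimed).  builds on p205010 (kernel theorem, internal audit signed; external expert review pending) — nothing
here uses p205010.  Def-free; no instance, no notation, no sorry.
* §1 (β5) `IsLaceKernel.unique` (refuter (U)): two lace kernels at the same `p`, one of norm `< 1`, coincide;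
* §2 (β6) `tsum_conv_eq_mul` (`Σ(a⋆b) = (Σa)(Σb)` on ℓ¹), `tsum_tauFun_eq` (`χ = a + p·a·4k·χ`), `inv_tsum_tauFun_eq` (`χ⁻¹ = a⁻¹ − 4kp`), `psiSum_pos`;
* §3 (β7) `inner_PsiOp_eq` (`⟪η,Ψη⟫ = a‖η‖² − Σ K ω_η`), `abs_inner_PsiOp_sub_le` (`≤ B κ(η)`, α (L4));
* §4 (β8) `inner_inverse_ge_tangent` (any self-adjoint unit with `Ψ⁻¹ ≽ 0`, any `a > 0`);
* §5 (β9) **`inner_XOp_ge_resolvent`**.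
[cite: HeydenreichVanDerHofstad2017, Lemma 8.11–8.12 ((8.4.14)–(8.4.29))] [cite: HaraSlade1990, §4]
-/

noncomputable section

namespace Summit.CriticalPhenomena.PercolationContinuityZ3.Theorems.Transplant

namespace Grigorchuk

namespace NcHaraSlade

open SimpleGraph Literature.Probability.Percolation Literature.Barriers.CriticalPhenomena
open scoped ENNReal Classical InnerProductSpace

variable {k : ℕ}

/-! ## §1 (β5) Uniqueness of the lace kernel (refuter (U)) -/

/-- **The ℓ¹ lace kernel is UNIQUE**: if `K` (with `‖K‖₁ < 1`) and `K'` are both lace kernels at `p < p_c`, then `K' = K` — both satisfy `T = Ψ (1 + pAT)` and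
`1 + pAT = Ψ⁻¹T` is a unit. [cite: HeydenreichVanDerHofstad2017, Lemma 8.11 (context)] -/
theorem IsLaceKernel.unique {p : unitInterval} {K K' : GPow k → ℝ} (hK : IsLaceKernel k p K) (hK' : IsLaceKernel k p K') (hp : (p : ℝ) < pcR k)
    (hK1 : ∑' x, |K x| < 1) : K' = K := by
  have hu := isUnit_PsiOp hK.summable_abs hK1
  have huT := isUnit_twoPointOp hK hp hK1
  set M := 1 + (p : ℝ) • (adjOp k * twoPointOp k p) with hM
  have h1 : twoPointOp k p = PsiOp K * M := twoPointOp_eq_PsiOp_mul hK hp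
  have h2 : twoPointOp k p = PsiOp K' * M := twoPointOp_eq_PsiOp_mul hK' hp
  -- `M = Ψ⁻¹ T` is a unit
  have hMeq : M = Ring.inverse (PsiOp K) * twoPointOp k p := by
    rw [h1, ← mul_assoc, Ring.inverse_mul_cancel _ hu, one_mul]
  have huM : IsUnit M := by rw [hMeq]; exact hu.ringInverse.mul huT
  have hΨ : PsiOp K' = PsiOp K := by
    have h := h2.symm.trans h1
    calc PsiOp K' = PsiOp K' * M * Ring.inverse M := by rw [mul_assoc, Ring.mul_inverse_cancel _ huM, mul_one]
      _ = PsiOp K * M * Ring.inverse M := by rw [h]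
      _ = PsiOp K := by rw [mul_assoc, Ring.mul_inverse_cancel _ huM, mul_one]
  rw [PsiOp, PsiOp, add_right_inj] at hΨ
  exact kernelOp_injective hK'.summable_abs hK.summable_abs hΨ

/-! ## §2 (β6) The trivial character: `χ⁻¹ = a⁻¹ − 4kp` -/

/-- **`Σ_m Σ_g a(g) b(g⁻¹m) = (Σ a)(Σ b)`** for `a, b ∈ ℓ¹` (the trivial character of a convolution). [folklore] -/
theorem tsum_conv_eq_mul {a b : GPow k → ℝ} (ha : Summable fun g => |a g|) (hb : Summable fun g => |b g|) :
    ∑' m, ∑' g, a g * b (g⁻¹ * m) = (∑' g, a g) * ∑' g, b g := by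
  have ha' : Summable fun g => ‖a g‖ := by simpa only [Real.norm_eq_abs] using ha
  have hb' : Summable fun g => ‖b g‖ := by simpa only [Real.norm_eq_abs] using hb
  set e : GPow k × GPow k ≃ GPow k × GPow k :=
    ⟨fun z => (z.1 * z.2, z.1), fun q => (q.2, q.2⁻¹ * q.1), fun z => by simp, fun q => by simp⟩ with he
  obtain ⟨Φ, hΦ⟩ : ∃ Φ : GPow k × GPow k → ℝ, Φ = fun q => a q.2 * b (q.2⁻¹ * q.1) := ⟨_, rfl⟩
  have hΦe : ∀ z : GPow k × GPow k, Φ (e z) = a z.1 * b z.2 := fun z => by simp [hΦ, he]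
  have hΦs : Summable Φ := by
    have h := summable_mul_of_summable_norm ha' hb'
    exact e.summable_iff.1 (by simpa only [Function.comp_def, hΦe] using h)
  calc ∑' m, ∑' g, a g * b (g⁻¹ * m) = ∑' m, ∑' g, Φ (m, g) := by simp only [hΦ]
    _ = ∑' q : GPow k × GPow k, Φ q := hΦs.tsum_prod.symm
    _ = ∑' z : GPow k × GPow k, Φ (e z) := (e.tsum_eq Φ).symm
    _ = ∑' z : GPow k × GPow k, a z.1 * b z.2 := tsum_congr hΦe
    _ = (∑' g, a g) * ∑' g, b g := (tsum_mul_tsum_of_summable_norm ha' hb').symm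

/-- The renewal identity pointwise, with `(x s)⁻¹ g = s⁻¹(x⁻¹ g)`: `τ(g) = Ψ(g) + p · (Ψ ⋆ (𝟙_S ⋆ τ))(g)`. [cite: HeydenreichVanDerHofstad2017, §6.2] -/
theorem tauFun_renewal_apply {p : unitInterval} {K : GPow k → ℝ} (hK : IsLaceKernel k p K) (g : GPow k) :
    tauFun k p g = (deltaFun k g + K g) + (p : ℝ) * ∑' x, (deltaFun k x + K x) * ∑ s ∈ gkGens k, tauFun k p (s⁻¹ * (x⁻¹ * g)) := by
  rw [hK.renewal g]
  have hx : ∀ x : GPow k, ∑ s ∈ gkGens k, tauFun k p ((x * s)⁻¹ * g) = ∑ s ∈ gkGens k, tauFun k p (s⁻¹ * (x⁻¹ * g)) :=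
    fun x => Finset.sum_congr rfl fun s _ => by rw [mul_inv_rev, mul_assoc]
  simp_rw [hx]

/-- `Σ_g (δ + K)(g) = 1 + Σ K`. [folklore] -/
theorem tsum_delta_add {K : GPow k → ℝ} (hK : Summable fun x => |K x|) : ∑' g, (deltaFun k g + K g) = 1 + ∑' g, K g := by
  rw [(summable_abs_deltaFun (k := k)).of_abs.tsum_add hK.of_abs, tsum_eq_single (1 : GPow k) (fun g hg => deltaFun_of_ne_one hg), deltaFun_one]

/-- `Σ_m Σ_{s ∈ S_k} τ(s⁻¹ m) = 4k χ` below `p_c`. [folklore] -/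
theorem tsum_sum_gkGens_tauFun {p : unitInterval} (hp : (p : ℝ) < pcR k) :
    ∑' m, ∑ s ∈ gkGens k, tauFun k p (s⁻¹ * m) = 4 * k * ∑' g, tauFun k p g := by
  have hs : ∀ s ∈ gkGens k, Summable fun m => tauFun k p (s⁻¹ * m) := fun s _ => by
    simpa only [Function.comp_def, Equiv.coe_mulLeft] using (Equiv.mulLeft s⁻¹).summable_iff.2 (summable_tauFun hp)
  have ht : ∀ s ∈ gkGens k, ∑' m, tauFun k p (s⁻¹ * m) = ∑' m, tauFun k p m := fun s _ => by
    simpa only [Equiv.coe_mulLeft] using (Equiv.mulLeft s⁻¹).tsum_eq (tauFun k p)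
  rw [Summable.tsum_finsetSum hs, Finset.sum_congr rfl ht, Finset.sum_const, card_gkGens, nsmul_eq_mul]
  push_cast
  ring

/-- **The trivial character of the renewal identity**: with `a := 1 + Σ K` and `χ := Σ τ_p`, `χ = a + p · (a · (4k χ))`. [cite: HeydenreichVanDerHofstad2017, §8.4 (zero mode of the renewal identity)] -/
theorem tsum_tauFun_eq {p : unitInterval} {K : GPow k → ℝ} (hK : IsLaceKernel k p K) (hp : (p : ℝ) < pcR k) :
    ∑' g, tauFun k p g = (1 + ∑' g, K g) + (p : ℝ) * ((1 + ∑' g, K g) * (4 * k * ∑' g, tauFun k p g)) := by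
  have hΨ := summable_abs_delta_add hK.summable_abs
  have hSτ : Summable fun m => |∑ s ∈ gkGens k, tauFun k p (s⁻¹ * m)| := by
    have h := summable_abs_conv (summable_abs_indicator_gkGens (k := k)) (summable_abs_tauFun hp)
    simp_rw [conv_indicator_gkGens] at h
    exact h
  have hconv := summable_abs_conv hΨ hSτ
  have h1 : Summable fun g => deltaFun k g + K g := hΨ.of_abs
  have h2 : Summable fun g => (p : ℝ) * ∑' x, (deltaFun k x + K x) * ∑ s ∈ gkGens k, tauFun k p (s⁻¹ * (x⁻¹ * g)) :=
    hconv.of_abs.mul_left (p : ℝ)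
  calc ∑' g, tauFun k p g
      = ∑' g, ((deltaFun k g + K g) + (p : ℝ) * ∑' x, (deltaFun k x + K x) * ∑ s ∈ gkGens k, tauFun k p (s⁻¹ * (x⁻¹ * g))) :=
        tsum_congr fun g => tauFun_renewal_apply hK g
    _ = ∑' g, (deltaFun k g + K g) + ∑' g, (p : ℝ) * ∑' x, (deltaFun k x + K x) * ∑ s ∈ gkGens k, tauFun k p (s⁻¹ * (x⁻¹ * g)) :=
        h1.tsum_add h2
    _ = (1 + ∑' g, K g) + (p : ℝ) * ((1 + ∑' g, K g) * ∑' m, ∑ s ∈ gkGens k, tauFun k p (s⁻¹ * m)) := by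
        rw [tsum_mul_left, tsum_conv_eq_mul hΨ hSτ, tsum_delta_add hK.summable_abs]
    _ = _ := by rw [tsum_sum_gkGens_tauFun hp]

/-- `χ ≥ 1` as a `tsum` of `tauFun` (`τ(1) = 1`). [folklore] -/
theorem one_le_tsum_tauFun {p : unitInterval} (hp : (p : ℝ) < pcR k) : 1 ≤ ∑' g, tauFun k p g := by
  rw [← tauFun_one (k := k) p]
  exact (summable_tauFun hp).le_tsum 1 fun g _ => tauFun_nonneg p g

/-- **`χ⁻¹ = a⁻¹ − 4kp`** and **`0 < a`** (`a = 1 + Σ K`), from the trivial character (refuter (37.2)(ii)). [cite: HeydenreichVanDerHofstad2017, Lemma 8.12 ((8.4.15))] -/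
theorem inv_tsum_tauFun_eq {p : unitInterval} {K : GPow k → ℝ} (hK : IsLaceKernel k p K) (hp : (p : ℝ) < pcR k) :
    0 < 1 + ∑' g, K g ∧ (∑' g, tauFun k p g)⁻¹ = (1 + ∑' g, K g)⁻¹ - 4 * k * (p : ℝ) := by
  set a : ℝ := 1 + ∑' g, K g with ha
  set χ : ℝ := ∑' g, tauFun k p g with hχ
  have hχ1 : 1 ≤ χ := one_le_tsum_tauFun hp
  have hχ0 : 0 < χ := by linarith
  have key : χ = a + (p : ℝ) * (a * (4 * k * χ)) := tsum_tauFun_eq hK hp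
  have hfac : χ * (1 - 4 * k * (p : ℝ) * a) = a := by linear_combination key
  have ha0 : a ≠ 0 := by
    intro h0
    have : χ = 0 := by rw [key, h0]; ring
    linarith
  have hapos : 0 < a := by
    -- `a = χ (1 − 4kp a)`; if `a < 0` then `1 − 4kp a > 0` so `a > 0`, contradiction
    by_contra hneg
    push Not at hneg
    have hlt : a < 0 := lt_of_le_of_ne hneg ha0
    have hp0 : 0 ≤ (p : ℝ) := p.2.1
    have hk0 : (0 : ℝ) ≤ k := Nat.cast_nonneg k
    have : 0 < 1 - 4 * k * (p : ℝ) * a := by nlinarith [mul_nonneg hk0 hp0]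
    have : 0 < χ * (1 - 4 * k * (p : ℝ) * a) := mul_pos hχ0 this
    linarith
  refine ⟨hapos, ?_⟩
  have h1 : 1 - 4 * k * (p : ℝ) * a = a / χ := by field_simp; linear_combination hfac
  calc χ⁻¹ = (a / χ) / a := by field_simp
    _ = (1 - 4 * k * (p : ℝ) * a) / a := by rw [h1]
    _ = a⁻¹ - 4 * k * (p : ℝ) := by field_simp

/-! ## §3 (β7) `Ψ = a − Ω` as quadratic forms -/

/-- **`⟪η, Ψ η⟫ = a ‖η‖² − Σ_x K(x) ω_η(x)`**, `a = 1 + Σ K` (α (L3) + `‖η‖²`). [cite: HeydenreichVanDerHofstad2017, §8.3 (Ψ̂ = a − Ω̂)] -/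
theorem inner_PsiOp_eq {K : GPow k → ℝ} (hK : Summable fun x => |K x|) (η : lp (fun _ : GPow k => ℝ) 2) :
    ⟪η, PsiOp K η⟫_ℝ = (1 + ∑' x, K x) * ‖η‖ ^ 2 - ∑' x, K x * omegaL2 η x := by
  rw [PsiOp, add_apply, one_apply_eq_self, inner_add_right, real_inner_self_eq_norm_sq, inner_kernelOp_eq hK]
  ring

/-- **`|⟪η, Ψ η⟫ − a‖η‖²| ≤ B κ(η)`** (`k ≥ 1`) under the `⨆`-clause of the lace norm with constant `B` (α (L4): `±Ω ≼ B(1 − P)`).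
[cite: HeydenreichVanDerHofstad2017, Prop. 8.3, Lemma 8.11] -/
theorem abs_inner_PsiOp_sub_le (hk : 1 ≤ k) {K : GPow k → ℝ} (hK : Summable fun x => |K x|) {B : ℝ}
    (hB : ∀ ξ : GPow k →₀ ℝ, 0 < kappa0 k ξ → ∑' x, |K x| * omegaV ξ x ≤ B * kappa0 k ξ) (η : lp (fun _ : GPow k => ℝ) 2) :
    |⟪η, PsiOp K η⟫_ℝ - (1 + ∑' x, K x) * ‖η‖ ^ 2| ≤ B * kappaL2 k η := by
  rw [inner_PsiOp_eq hK, sub_sub_cancel_left, abs_neg]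
  have hs := summable_mul_omegaL2 η hK
  have hn : Summable fun x => ‖K x * omegaL2 η x‖ := by simpa only [Real.norm_eq_abs] using hs.abs
  calc |∑' x, K x * omegaL2 η x| ≤ ∑' x, |K x * omegaL2 η x| := by
        have h := norm_tsum_le_tsum_norm hn
        simpa only [Real.norm_eq_abs] using h
    _ = ∑' x, |K x| * omegaL2 η x := tsum_congr fun x => by rw [abs_mul, abs_of_nonneg (omegaL2_nonneg η x)]
    _ ≤ B * kappaL2 k η := tsum_abs_mul_omegaL2_le hk hK hB η

/-! ## §4 (β8) The tangent inequality at a scalar -/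

/-- **TANGENT INEQUALITY `Ψ⁻¹ ≽ 2a⁻¹ − a⁻²Ψ`**: for a self-adjoint unit `Ψ` of the operator ring with `Ψ⁻¹ ≽ 0` and ANY real `a > 0`,
`⟪η, Ψ⁻¹η⟫ ≥ 2a⁻¹‖η‖² − a⁻²⟪η, Ψη⟫` — expand `0 ≤ ⟪(Ψ − a)η, Ψ⁻¹(Ψ − a)η⟫` (P3-NILPOTENT (37.2)(iii); no functional calculus). [cite: HeydenreichVanDerHofstad2017, Lemma 8.12 ((8.4.20)–(8.4.22))] -/
theorem inner_inverse_ge_tangent (Ψ : lp (fun _ : GPow k => ℝ) 2 →L[ℝ] lp (fun _ : GPow k => ℝ) 2) (hu : IsUnit Ψ) (hsa : ContinuousLinearMap.adjoint Ψ = Ψ)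
    (hpos : ∀ ζ, 0 ≤ ⟪ζ, Ring.inverse Ψ ζ⟫_ℝ) {a : ℝ} (ha : 0 < a) (η : lp (fun _ : GPow k => ℝ) 2) :
    2 * a⁻¹ * ‖η‖ ^ 2 - a⁻¹ ^ 2 * ⟪η, Ψ η⟫_ℝ ≤ ⟪η, Ring.inverse Ψ η⟫_ℝ := by
  have hinv : ∀ ζ, Ring.inverse Ψ (Ψ ζ) = ζ := fun ζ => by rw [← mul_apply_eq_comp, Ring.inverse_mul_cancel _ hu, one_apply_eq_self]
  have hinv' : ∀ ζ, Ψ (Ring.inverse Ψ ζ) = ζ := fun ζ => by rw [← mul_apply_eq_comp, Ring.mul_inverse_cancel _ hu, one_apply_eq_self]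
  have h0 := hpos (Ψ η - a • η)
  have hζ : Ring.inverse Ψ (Ψ η - a • η) = η - a • Ring.inverse Ψ η := by rw [map_sub, map_smul, hinv]
  have h1 : ⟪Ψ η, Ring.inverse Ψ η⟫_ℝ = ‖η‖ ^ 2 := by
    rw [← ContinuousLinearMap.adjoint_inner_right, hsa, hinv', real_inner_self_eq_norm_sq]
  have h2 : ⟪Ψ η, η⟫_ℝ = ⟪η, Ψ η⟫_ℝ := real_inner_comm _ _
  rw [hζ, inner_sub_left, inner_sub_right, inner_sub_right, real_inner_smul_left, real_inner_smul_left, real_inner_smul_right, real_inner_smul_right,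
    h1, h2, real_inner_self_eq_norm_sq] at h0
  -- `h0 : 0 ≤ ⟪η,Ψη⟫ − a ⟪η,Ψ⁻¹η⟫·… `; rearrange
  rw [show 2 * a⁻¹ * ‖η‖ ^ 2 - a⁻¹ ^ 2 * ⟪η, Ψ η⟫_ℝ = (2 * a * ‖η‖ ^ 2 - ⟪η, Ψ η⟫_ℝ) / a ^ 2 by field_simp,
    div_le_iff₀ (by positivity)]
  nlinarith [h0, ha]

/-! ## §5 (β9) The resolvent form lower bound -/

/-- `⟪η, A η⟫ = 4k (‖η‖² − κ(η))` (`k ≥ 1`; `κ(η) = ⟪η, (1 − P)η⟫`, `A = 4k P`). [folklore] -/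
theorem inner_adjOp_eq (hk : 1 ≤ k) (η : lp (fun _ : GPow k => ℝ) 2) : ⟪η, adjOp k η⟫_ℝ = 4 * k * (‖η‖ ^ 2 - kappaL2 k η) := by
  have h1 : (1 : ℝ) ≤ k := by exact_mod_cast hk
  have hk' : (4 * (k : ℝ)) ≠ 0 := by positivity
  unfold kappaL2
  rw [sub_apply, one_apply_eq_self, inner_sub_right, real_inner_self_eq_norm_sq, srwOp, FunLike.coe_smul, Pi.smul_apply, real_inner_smul_right]
  field_simp
  ring

/-- **β's EXPORT — THE RESOLVENT FORM LOWER BOUND** (P3-NILPOTENT (37.2)(iv), first line): for a lace kernel `K` at `p < p_c` with `‖K‖₁ < 1` and the weighted bound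
with constant `B` (the `⨆`-clause of `laceNormE k K ≤ B`), `X = T⁻¹ = Ψ⁻¹ − 4kp·P` satisfies, for every `η ∈ ℓ²(𝔊^k)` (`k ≥ 1`),
`⟪η, X η⟫ ≥ χ⁻¹ ‖η‖² + (4kp − a⁻² B) κ(η)` with `a = 1 + Σ K`, `χ = Σ τ_p` (`a⁻¹ − 4kp = χ⁻¹`).  Nothing asserts that such `K` exists (S3a′).
[cite: HeydenreichVanDerHofstad2017, Lemma 8.12 ((8.4.22)–(8.4.29))] -/
theorem inner_XOp_ge_resolvent (hk : 1 ≤ k) {p : unitInterval} {K : GPow k → ℝ} (hK : IsLaceKernel k p K) (hp : (p : ℝ) < pcR k) (hK1 : ∑' x, |K x| < 1)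
    {B : ℝ} (hB : ∀ ξ : GPow k →₀ ℝ, 0 < kappa0 k ξ → ∑' x, |K x| * omegaV ξ x ≤ B * kappa0 k ξ) (η : lp (fun _ : GPow k => ℝ) 2) :
    (∑' g, tauFun k p g)⁻¹ * ‖η‖ ^ 2 + (4 * k * (p : ℝ) - (1 + ∑' x, K x)⁻¹ ^ 2 * B) * kappaL2 k η ≤ ⟪η, XOp k p K η⟫_ℝ := by
  obtain ⟨hapos, hinvχ⟩ := inv_tsum_tauFun_eq hK hp
  set a : ℝ := 1 + ∑' x, K x with ha
  have hu := isUnit_PsiOp hK.summable_abs hK1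
  have hX : ⟪η, XOp k p K η⟫_ℝ = ⟪η, Ring.inverse (PsiOp K) η⟫_ℝ - (p : ℝ) * ⟪η, adjOp k η⟫_ℝ := by
    rw [XOp, sub_apply, FunLike.coe_smul, Pi.smul_apply, inner_sub_right, real_inner_smul_right]
  have ht := inner_inverse_ge_tangent (PsiOp K) hu (adjoint_PsiOp hK hp hK1) (inner_inverse_PsiOp_nonneg hK.summable_abs hK1) hapos η
  have hΨ := (abs_le.1 (abs_inner_PsiOp_sub_le hk hK.summable_abs hB η)).2
  have h5 : a⁻¹ ^ 2 * ⟪η, PsiOp K η⟫_ℝ ≤ a⁻¹ ^ 2 * (a * ‖η‖ ^ 2 + B * kappaL2 k η) := mul_le_mul_of_nonneg_left (by linarith) (sq_nonneg _)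
  have h6 : a⁻¹ ^ 2 * (a * ‖η‖ ^ 2 + B * kappaL2 k η) = a⁻¹ * ‖η‖ ^ 2 + a⁻¹ ^ 2 * B * kappaL2 k η := by
    field_simp
  rw [hX, inner_adjOp_eq hk, hinvχ]
  nlinarith [ht, h5, h6]

end NcHaraSlade

end Grigorchuk

end Summit.CriticalPhenomena.PercolationContinuityZ3.Theorems.Transplant

end
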